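import Literature.NumberTheory.Sieve.BombieriFriedlanderIwaniecCombinatorics

/-!
# Correlation sieve for line `Sketch` of the crux `EngineToPairs` (stmt-Parity-14659), part 5:
# the exponent trichotomy with slack, and the largeness thresholds

Support file for the stub `stub_sieve : CorrelationSieveFamily`.  Pure real-number bookkeeping:

* `trichotomy_slack` — the exponent classification behind the Heath-Brown `K = 3` casework, for exponents
  `f_i ≥ 0` with `∑ f_i ∈ [1 − δ/20, 1]` (base `x`, the slack absorbing the dyadic rounding) and Möbius
  exponents `≤ 1/3 + δ/20`: a partial sum in `[3δ/5, 1/3 + 9δ/10]` (Type II), or a smooth exponent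
  `≥ 1/2 + 21δ/10` (Type I), or two smooth exponents in `(1/2 − 3δ, 1/2 + 21δ/10)` with the rest `< 3δ/5`
  (Type I₂) — adapted from the ideator's `engine_trichotomy` (Cruxes/EngineToPairs/SketchIdeator1.lean, which
  assumed `∑ f_i = 1`), itself from the tree's `BFI.exists_subsum_mem_Icc_or`;
* `Large δ x` — the finitely many largeness conditions on `x` used by the dispatch, and `exists_large` —
  they hold for all `x ≥ x₀(δ)`;
* `rpow_log_div_log`, `prod_boxLow_eq_rpow` helpers: `lo = x^{log lo / log x}`.
-/

noncomputable section

namespace Summit.Parity.GeneralizedHardyLittlewood.Theorems.EngineToPairs.Sieve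

open Finset Real Filter

/-! ### The trichotomy with slack -/

/-- **Exponent trichotomy (base `x`, with slack).**  Let `0 < δ ≤ 1/100`, `f_i ≥ 0` with
`1 − δ/20 ≤ ∑ f_i ≤ 1`, and `f_i ≤ 1/3 + δ/20` for the non-smooth (Möbius) indices.  Then either some
partial sum lies in `[3δ/5, 1/3 + 9δ/10]`, or some smooth `f_i ≥ 1/2 + 21δ/10`, or two distinct smooth
indices have `f ∈ (1/2 − 3δ, 1/2 + 21δ/10)` and all the others total `< 3δ/5`.
[folklore; adapted from Cruxes/EngineToPairs/SketchIdeator1.lean `engine_trichotomy`] -/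
theorem trichotomy_slack {ι : Type*} [Fintype ι] [DecidableEq ι] (f : ι → ℝ) (smooth : ι → Prop)
    [DecidablePred smooth] {δ : ℝ} (hδ : 0 < δ) (hδ' : δ ≤ 1 / 100) (hnn : ∀ i, 0 ≤ f i)
    (hsum1 : ∑ i, f i ≤ 1) (hsum2 : 1 - δ / 20 ≤ ∑ i, f i) (hmu : ∀ i, ¬ smooth i → f i ≤ 1 / 3 + δ / 20) :
    (∃ s : Finset ι, 3 * δ / 5 ≤ ∑ i ∈ s, f i ∧ ∑ i ∈ s, f i ≤ 1 / 3 + 9 * δ / 10) ∨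
    (∃ i, smooth i ∧ 1 / 2 + 21 * δ / 10 ≤ f i) ∨
    (∃ i j, i ≠ j ∧ smooth i ∧ smooth j ∧
        1 / 2 - 3 * δ < f i ∧ f i < 1 / 2 + 21 * δ / 10 ∧
        1 / 2 - 3 * δ < f j ∧ f j < 1 / 2 + 21 * δ / 10 ∧
        ∑ k ∈ (univ.erase i).erase j, f k < 3 * δ / 5) := by
  -- adapted from Cruxes/EngineToPairs/SketchIdeator1.lean (engine_trichotomy), with `∑ f = 1` relaxed
  rcases Literature.NumberTheory.Sieve.BFI.exists_subsum_mem_Icc_or f (a := 3 * δ / 5)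
      (b := 1 / 3 + 9 * δ / 10) (by positivity) (by linarith) with h | ⟨hsmall, hbig⟩
  · exact Or.inl h
  right
  have hsub : ∀ t : Finset ι, (∀ k ∈ t, f k < 3 * δ / 5) → ∑ k ∈ t, f k < 3 * δ / 5 := by
    intro t ht
    refine lt_of_le_of_lt ?_ hsmall
    apply Finset.sum_le_sum_of_subset_of_nonneg
    · intro k hk
      exact Finset.mem_filter.2 ⟨Finset.mem_univ _, ht k hk⟩
    · intro k _ _
      exact hnn k
  have hsmooth : ∀ i, 3 * δ / 5 ≤ f i → smooth i := by
    intro i hi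
    by_contra hns
    have h1 := hmu i hns
    have h2 := hbig i hi
    linarith
  have hex : ∃ i, 3 * δ / 5 ≤ f i := by
    by_contra hnone
    push Not at hnone
    have h1 := hsub univ (fun k _ => hnone k)
    linarith
  obtain ⟨i, hi⟩ := hex
  have hTi : ∑ k ∈ univ.erase i, f k = (∑ k, f k) - f i := by
    rw [Finset.sum_erase_eq_sub (Finset.mem_univ i)]
  by_cases hcase : ∀ j ∈ univ.erase i, f j < 3 * δ / 5
  · left
    refine ⟨i, hsmooth i hi, ?_⟩
    have h1 := hsub _ hcase
    rw [hTi] at h1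
    linarith
  · push Not at hcase
    obtain ⟨j, hjmem, hj⟩ := hcase
    have hji : j ≠ i := Finset.ne_of_mem_erase hjmem
    have hTij : ∑ k ∈ (univ.erase i).erase j, f k = (∑ k, f k) - f i - f j := by
      rw [Finset.sum_erase_eq_sub hjmem, hTi]
    have hrest : ∀ k ∈ (univ.erase i).erase j, f k < 3 * δ / 5 := by
      intro k hk
      by_contra hk'
      push Not at hk'
      have hbk := hbig k hk'
      have hbi := hbig i hi
      have hbj := hbig j hj
      have hle : f k ≤ ∑ l ∈ (univ.erase i).erase j, f l :=
        Finset.single_le_sum (fun l _ => hnn l) hk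
      rw [hTij] at hle
      linarith
    have hsmallrest := hsub _ hrest
    by_cases hI : 1 / 2 + 21 * δ / 10 ≤ f i
    · left
      exact ⟨i, hsmooth i hi, hI⟩
    by_cases hJ : 1 / 2 + 21 * δ / 10 ≤ f j
    · left
      exact ⟨j, hsmooth j hj, hJ⟩
    push Not at hI hJ
    right
    have hs' := hsmallrest
    rw [hTij] at hs'
    refine ⟨i, j, hji.symm, hsmooth i hi, hsmooth j hj, ?_, hI, ?_, hJ, hsmallrest⟩
    · linarith
    · linarith

/-! ### Largeness thresholds -/

/-- The finitely many largeness conditions on `x` used by the correlation-sieve dispatch for the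
parameter `δ`. [this line] -/
structure Large (δ x : ℝ) : Prop where
  sixteen_le : 16 ≤ x
  one_le_log : 1 ≤ Real.log x
  log_ge : 140 * Real.log 2 / δ ≤ Real.log x
  rpow_tenth : 64 ≤ x ^ (δ / 10)
  rpow_two_fifths : 512 ≤ x ^ (2 * δ / 5)
  rpow_vac : 1024 ≤ x ^ (1 / 20 - 13 * δ / 5)

/-- The largeness conditions hold for all `x ≥ x₀(δ)` (`0 < δ ≤ 1/100`). [folklore] -/
theorem exists_large {δ : ℝ} (hδ : 0 < δ) (hδ' : δ ≤ 1 / 100) : ∃ x₀ : ℝ, ∀ x : ℝ, x₀ ≤ x → Large δ x := by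
  have h1 : ∀ᶠ x : ℝ in atTop, 16 ≤ x := eventually_ge_atTop 16
  have h2 : ∀ᶠ x : ℝ in atTop, 1 ≤ Real.log x := Real.tendsto_log_atTop.eventually_ge_atTop 1
  have h3 : ∀ᶠ x : ℝ in atTop, 140 * Real.log 2 / δ ≤ Real.log x :=
    Real.tendsto_log_atTop.eventually_ge_atTop _
  have h4 : ∀ᶠ x : ℝ in atTop, 64 ≤ x ^ (δ / 10) :=
    (tendsto_rpow_atTop (by positivity)).eventually_ge_atTop 64
  have h5 : ∀ᶠ x : ℝ in atTop, 512 ≤ x ^ (2 * δ / 5) :=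
    (tendsto_rpow_atTop (by positivity)).eventually_ge_atTop 512
  have h6 : ∀ᶠ x : ℝ in atTop, 1024 ≤ x ^ (1 / 20 - 13 * δ / 5) :=
    (tendsto_rpow_atTop (by linarith)).eventually_ge_atTop 1024
  obtain ⟨x₀, hx₀⟩ := eventually_atTop.1 (h1.and (h2.and (h3.and (h4.and (h5.and h6)))))
  exact ⟨x₀, fun x hx => let h := hx₀ x hx; ⟨h.1, h.2.1, h.2.2.1, h.2.2.2.1, h.2.2.2.2.1, h.2.2.2.2.2⟩⟩

namespace Large

variable {δ x : ℝ} (h : Large δ x)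
include h

/-- `1 < x`. [folklore] -/
theorem one_lt : 1 < x := by linarith [h.sixteen_le]

/-- `0 < x`. [folklore] -/
theorem pos : 0 < x := by linarith [h.sixteen_le]

/-- `0 < log x`. [folklore] -/
theorem log_pos : 0 < Real.log x := by linarith [h.one_le_log]

/-- `log 2 / log x ≤ δ / 140`. [folklore] -/
theorem log_two_div_log_le (hδ : 0 < δ) : Real.log 2 / Real.log x ≤ δ / 140 := by
  rw [div_le_div_iff₀ h.log_pos (by norm_num : (0 : ℝ) < 140)]
  have := h.log_ge
  rw [div_le_iff₀ hδ] at this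
  linarith

/-- `32 ≤ x^{δ/10}` and hence `32 x^{a} ≤ x^{a + δ/10}`-type absorptions. [folklore] -/
theorem thirtytwo_mul_rpow_le (a : ℝ) : 32 * x ^ a ≤ x ^ (a + δ / 10) := by
  rw [Real.rpow_add h.pos]
  have := h.rpow_tenth
  have h0 : 0 ≤ x ^ a := Real.rpow_nonneg h.pos.le a
  nlinarith

/-- `64 x^{a} ≤ x^{a + δ/10}`. [folklore] -/
theorem sixtyfour_mul_rpow_le (a : ℝ) : 64 * x ^ a ≤ x ^ (a + δ / 10) := by
  rw [Real.rpow_add h.pos]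
  have := h.rpow_tenth
  have h0 : 0 ≤ x ^ a := Real.rpow_nonneg h.pos.le a
  nlinarith

/-- `512 x^{a} ≤ x^{a + 2δ/5}`. [folklore] -/
theorem fivetwelve_mul_rpow_le (a : ℝ) : 512 * x ^ a ≤ x ^ (a + 2 * δ / 5) := by
  rw [Real.rpow_add h.pos]
  have := h.rpow_two_fifths
  have h0 : 0 ≤ x ^ a := Real.rpow_nonneg h.pos.le a
  nlinarith

/-- `1024 x^{19/20 + 13δ/5} ≤ x`. [folklore] -/
theorem vac_le : 1024 * x ^ (19 / 20 + 13 * δ / 5) ≤ x := by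
  have e : x ^ (19 / 20 + 13 * δ / 5) * x ^ (1 / 20 - 13 * δ / 5) = x := by
    rw [← Real.rpow_add h.pos]; norm_num
  have h0 : 0 ≤ x ^ (19 / 20 + 13 * δ / 5) := Real.rpow_nonneg h.pos.le _
  calc 1024 * x ^ (19 / 20 + 13 * δ / 5) = x ^ (19 / 20 + 13 * δ / 5) * 1024 := by ring
    _ ≤ x ^ (19 / 20 + 13 * δ / 5) * x ^ (1 / 20 - 13 * δ / 5) := mul_le_mul_of_nonneg_left h.rpow_vac h0
    _ = x := e

end Large

/-! ### Exponents of box ends -/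

/-- For `x > 1` and `lo > 0`: `x ^ (log lo / log x) = lo`. [folklore] -/
theorem rpow_log_div_log {x lo : ℝ} (hx : 1 < x) (hlo : 0 < lo) : x ^ (Real.log lo / Real.log x) = lo := by
  have hlogx : Real.log x ≠ 0 := (Real.log_pos hx).ne'
  rw [Real.rpow_def_of_pos (by linarith), mul_div_cancel₀ _ hlogx, Real.exp_log hlo]

/-- A product of positive reals as a power of `x`: `∏_{i∈s} lo_i = x ^ (∑_{i∈s} log lo_i / log x)`. [folklore] -/
theorem prod_eq_rpow_sum_log_div {ι : Type*} (s : Finset ι) {x : ℝ} (hx : 1 < x) (lo : ι → ℝ)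
    (hlo : ∀ i ∈ s, 0 < lo i) : ∏ i ∈ s, lo i = x ^ (∑ i ∈ s, Real.log (lo i) / Real.log x) := by
  rw [Real.rpow_sum_of_pos (by linarith) _ s]
  exact Finset.prod_congr rfl fun i hi => (rpow_log_div_log hx (hlo i hi)).symm

/-- The exponent of a positive real `lo ≤ x` relative to `x` lies in `(-∞, 1]`, and is `≥ 0` iff `1 ≤ lo`.
[folklore] -/
theorem log_div_log_nonneg {x lo : ℝ} (hx : 1 < x) (hlo : 1 ≤ lo) : 0 ≤ Real.log lo / Real.log x :=
  div_nonneg (Real.log_nonneg hlo) (Real.log_pos hx).le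

/-- Comparing powers of `x > 1`: `x^a ≤ x^b ↔ a ≤ b`, in the two directions we use. [folklore] -/
theorem rpow_le_rpow_iff_left {x a b : ℝ} (hx : 1 < x) : x ^ a ≤ x ^ b ↔ a ≤ b :=
  Real.rpow_le_rpow_left_iff hx

/-- Comparing powers of `x > 1`, strict. [folklore] -/
theorem rpow_lt_rpow_iff_left {x a b : ℝ} (hx : 1 < x) : x ^ a < x ^ b ↔ a < b :=
  Real.rpow_lt_rpow_left_iff hx

end Summit.Parity.GeneralizedHardyLittlewood.Theorems.EngineToPairs.Sieve

namespace Summit.Parity.GeneralizedHardyLittlewood.Theorems.EngineToPairs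

/-- Registered sub-goal of `stub_sieve` carried by this part (landing mechanics): `x^{log lo/log x} = lo`.
[folklore] -/
theorem sieve_part5_anchor : ∀ (x lo : ℝ), 1 < x → 0 < lo → x ^ (Real.log lo / Real.log x) = lo :=
  fun _ _ hx hlo => Sieve.rpow_log_div_log hx hlo

end Summit.Parity.GeneralizedHardyLittlewood.Theorems.EngineToPairs

end
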